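import Mathlib.RingTheory.WittVector.Isocrystal
import Mathlib.RingTheory.WittVector.Compare
import Mathlib.Algebra.CharP.Algebra
import Mathlib.AlgebraicGeometry.Morphisms.Proper
import Literature.AlgebraicGeometry.Motives.BaseChange
import Literature.AlgebraicGeometry.Motives.DeRhamRealization
import Literature.AlgebraicGeometry.Motives.ChernClasses
import Literature.AlgebraicGeometry.Motives.Differentials
import HarnessLib

/-!
# Crystalline cohomology with its de Rham comparison, as a hypothesis structure

Let `k` be a perfect field of characteristic `p`, `W = W(k)` (Mathlib `WittVector p k`),
`K = W[1/p]` (Mathlib `K(p, k) = FractionRing (WittVector p k)`), and let `𝒳` be smooth and proper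
over `W` with special fibre `X_k` and thickenings `X_n = 𝒳 ⊗_W W/pⁿ`. The classical data are:

1. crystalline cohomology `Hⁱ_cris(X/W)` of `k`-schemes: finite `W`-modules with a `σ`-semilinear
   Frobenius `φ`, whose rationalisation `Hⁱ_cris(X/W) ⊗_W K` is a Weil cohomology theory on smooth
   projective `k`-varieties (Berthelot 1974, Ch. V–VII; Katz–Messing 1974; Gillet–Messing 1987);
2. the Berthelot–Ogus isomorphism `Hⁱ_dR(X_K/K) ≅ Hⁱ_cris(X_k/W) ⊗_W K` for `𝒳/W` smooth proper
   (Berthelot–Ogus 1983, Thm. 2.4 and Cor. 2.5; canonical, i.e. functorial, (2.4.5)), through which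
   the Hodge filtration `Fʳ Hⁱ_dR(X_K/K)` is seen on crystalline cohomology;
3. the crystalline Chern character `ch : K₀(X_k) → ⊕ᵣ H²ʳ_cris(X_k/W)_K` (Gros 1985; recalled in
   Bloch–Esnault–Kerz 2014, §2, (2.11)–(2.12)), additive, functorial, compatible with the de Rham
   Chern character of the generic fibre under (2) (Berthelot–Ogus 1983, Cor. 3.7 and Rem. 3.7.1) and
   with `φ(chᵣ) = pʳ chᵣ`;
4. cycle classes of algebraic cycles on `X_k`, lying in the `φ = pʳ` eigenspace (Ogus 1982, §4;
   Gillet–Messing 1987).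

None of this is constructible in Mathlib (there is no crystalline site, no de Rham complex of a
scheme, no `K₀` of a scheme; searched `crystalline`, `Isocrystal`, `deRham`, `Chern` in Mathlib:
only `WittVector.Isocrystal`, i.e. the semilinear-algebra shell). Following the two-speed design of
this directory (`WeilCohomology`, `DeRhamRealization`, `PeriodRealization`, `ChernClassTheory`) the
file records the data as a **hypothesis structure** `CrystallineRealization p k`, which EXTENDS
`WeilCohomology k K(p, k)` (the rational theory `X ↦ H•_cris(X/W) ⊗ K`) by: the integral lattices
`Hcris` with their semilinear Frobenius `frob` and the rational Frobenius `frobK`; a de Rham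
realization `dR : DeRhamRealization K(p, k)` of `K`-varieties together with the Berthelot–Ogus maps
`bo 𝒳 i : Hⁱ(X_k) →ₗ[K] Hⁱ_dR(X_K)` for `W`-schemes `𝒳`; and the two Chern characters `chCris`,
`chDR`. The axioms are the properties listed above (field docstrings carry the citations).

## The named-fact pattern (how routes consume this structure)

A closed statement `∀ C : CrystallineRealization p k, …` whose conclusion is a REAL statement about
schemes (e.g. "this sheaf on `X_k` lifts to `𝒳`") is refutable by exotic values of the structure.
Deep theorems about the CLASSICAL value are therefore recorded as `Prop`-valued definitions relative
to a fixed `C` (an explicit binder: they are predicates on `C`, not closed named facts, and have no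
`_holds` discharge), to be consumed as hypotheses `(h : Statement C)`, exactly as
`DeligneAbsoluteHodgeStatement P` in `Motives/ComparisonAbsolute`. This file provides the worked
instance `BerthelotOgusLineBundleLifting C` (Berthelot–Ogus 1983, Thm. 3.8: a line bundle `L` on
`X_k` lifts to the formal completion of `𝒳` iff `c₁^cris(L)` lies in `F¹ H²_dR(X_K/K)`), the real
vocabulary such statements need (namespace `WittScheme`: `specialFibre`, `genericFibre`,
`thickening 𝒳 n = X_n`, the transition maps, `LiftsToThickening`, `LiftsFormally`, `LiftsTo`,
`IsSmoothProperModel`; and `HasRank`), the Bloch–Esnault–Kerz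
Hodge condition `C.HodgeCondition 𝒳 E₁` ("`Φ⁻¹ ch^cris(E₁) ∈ ⊕ᵣ Fʳ H²ʳ_dR(X_K/K)`",
Bloch–Esnault–Kerz 2014, Thm. 1.3 (a)) and its easy converse `hodgeCondition_of_liftsTo` (proved).
The p-adic semiregular lifting statement of route `HodgeConjecture/PadicSemiregularLift` (P1) is
to be phrased the same way, `def … (C : CrystallineRealization p k) (…semiregularity data…) : Prop
:= ∀ 𝒳 E₁, … → C.HodgeCondition 𝒳 E₁ → LiftsFormally 𝒳 E₁`, once `defn-SemiregularityMap` lands.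

## What is deliberately NOT here

* Perfect complexes / `K₀`: Mathlib has no usable perfect complexes of `𝒪_X`-modules, so `chCris`
  is a function of `𝒪_X`-modules, meaningful (and axiomatised) on vector bundles only
  (`IsVectorBundle` of `Motives/ChernClasses`); Bloch–Esnault–Kerz's Thm. 1.3 itself
  (`K₀`-classes) is not stated.
* Multiplicativity of `ch` (no monoidal structure on `Scheme.Modules` at this Mathlib pin) and
  `ch₀ = rank` (no rank function).
* The INTEGRAL de Rham cohomology `Hⁱ_dR(𝒳/W)`, `Hⁱ_dR(X_n/W_n)` and their Hodge filtrations, and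
  the integral comparison `Hⁱ_dR(𝒳/W) ≅ Hⁱ_cris(X_k/W)` (Berthelot–Ogus 1983, (2.6.1)); every
  statement vendored here is rational, as printed (Thm. 3.8 and Bloch–Esnault–Kerz Thm. 1.3 are
  conditions in `H_dR(X_K/K)`).
* Junk values: `chCris X E r`, `chDR Y E r` on non-bundles (classically `0`, which is why the
  hypothesis-free axioms `*_congr`, `*_mem_ratAlgebraicClasses` are harmless); `thickening 𝒳 0`
  is the empty scheme (`W/p⁰ = 0`); all axioms are imposed on smooth projective / smooth proper
  objects only.

## References

* P. Berthelot, A. Ogus, *F-isocrystals and de Rham cohomology. I*, Invent. Math. 72 (1983):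
  Thm. 2.4, Cor. 2.5, (2.4.5), Prop. 3.4, Cor. 3.7, Rem. 3.7.1, Thm. 3.8. [BerthelotOgus1983]
* S. Bloch, H. Esnault, M. Kerz, *p-adic deformation of algebraic cycle classes*, Invent. Math.
  195 (2014), §1 (Thm. 1.3), §2 ((2.11)–(2.12)). [BlochEsnaultKerz2014pAdic]
* P. Berthelot, *Cohomologie cristalline des schémas de caractéristique p > 0*, LNM 407 (1974).
* A. Ogus, *Hodge cycles and crystalline cohomology*, in LNM 900 (1982), §4. [Ogus1982]
* M. Gros, *Classes de Chern et classes de cycles en cohomologie de Hodge–Witt logarithmique*,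
  Mém. SMF 21 (1985); H. Gillet, W. Messing, *Cycle classes and Riemann–Roch for crystalline
  cohomology*, Duke Math. J. 55 (1987); L. Illusie, *Complexe de de Rham–Witt*, ASENS 12 (1979).
-/

universe u

open CategoryTheory AlgebraicGeometry Limits Opposite
open scoped Isocrystal

noncomputable section

namespace Literature.AlgebraicGeometry.Motives

/-! ### Witt vectors: `W = W(k)`, `W_n = W/pⁿ`, the residue map -/

section Witt

variable (p : ℕ) [Fact p.Prime] (k : Type u) [CommRing k]

/-- `W_n(k) = W(k)/pⁿ`, the truncated Witt vectors as a quotient RING of `W(k)` (so that `W → W_n`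
is `algebraMap`); `W_0 = 0`, `W_1 = W/p ≅ k` (Bloch–Esnault–Kerz 2014, §1: `W_n = W/(pⁿ)`).
[cite: BlochEsnaultKerz2014pAdic, §1] -/
abbrev wittQuot (n : ℕ) : Type u := WittVector p k ⧸ Ideal.span {(p : WittVector p k)} ^ n

variable [CharP k p]

/-- `W(k)` has characteristic zero for `k` a nontrivial ring of characteristic `p`: it contains
`W(𝔽_p) ≅ ℤ_p` (Mathlib `WittVector.equiv`, `WittVector.map_injective`). Mathlib (this pin) has no
`CharZero (WittVector p k)` instance (searched `CharZero` in `RingTheory/WittVector`: none); it is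
needed for `K(p, k)` to be a coefficient field of a Weil cohomology theory. [folklore] -/
instance charZero_wittVector [Nontrivial k] : CharZero (WittVector p k) := by
  haveI : CharZero (WittVector p (ZMod p)) :=
    charZero_of_injective_ringHom (f := (WittVector.equiv p).symm.toRingHom)
      (WittVector.equiv p).symm.injective
  exact charZero_of_injective_ringHom (f := WittVector.map (ZMod.castHom (dvd_refl p) k))
    (WittVector.map_injective _ (ZMod.castHom (dvd_refl p) k).injective)

/-- The residue map `W(k) → k` kills `p` (`p = (0, 1, 0, …)` in `W(k)`, Mathlib
`WittVector.coeff_p_zero`; here via `CharP k p`). [folklore] -/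
theorem constantCoeff_natCast_prime : WittVector.constantCoeff (p : WittVector p k) = 0 := by
  rw [map_natCast, CharP.cast_eq_zero]

/-- `pⁿ⁺¹ W ⊆ ker (W → k)`. [folklore] -/
theorem span_prime_pow_le_ker (n : ℕ) :
    Ideal.span {(p : WittVector p k)} ^ (n + 1) ≤
      RingHom.ker (WittVector.constantCoeff : WittVector p k →+* k) := by
  refine (Ideal.pow_le_self (Nat.succ_ne_zero n)).trans ?_
  rw [Ideal.span_le, Set.singleton_subset_iff, SetLike.mem_coe, RingHom.mem_ker]
  exact constantCoeff_natCast_prime p k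

/-- The residue map `W_{n+1} = W/pⁿ⁺¹ → k` (reduction of a thickening to the special fibre).
[folklore] -/
def wittQuotToResidue (n : ℕ) : wittQuot p k (n + 1) →+* k :=
  Ideal.Quotient.lift _ WittVector.constantCoeff (fun _ ha => span_prime_pow_le_ker p k n ha)

/-- `(W_{n+1} → k) ∘ (W → W_{n+1}) = (W → k)`. [folklore] -/
theorem wittQuotToResidue_comp_algebraMap (n : ℕ) :
    (wittQuotToResidue p k n).comp (algebraMap (WittVector p k) (wittQuot p k (n + 1))) =
      WittVector.constantCoeff :=
  RingHom.ext fun _ => rfl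

end Witt

/-! ### Vector bundles of constant rank -/

/-- The `𝒪_X`-module `E` *has (constant) rank `r`*: it admits local trivialisations
`𝒪^{I_a}_{U_a} ≅ E|_{U_a}` over an open cover with `#I_a = r` for all `a` (Hartshorne II.5; `r = 1`:
a line bundle). Compare `HasRankLE` of `Motives/ChernClasses` (Mathlib has no rank function). [folklore] -/
def HasRank {X : Scheme.{u}} (E : X.Modules) (r : ℕ) : Prop :=
  ∃ q : SheafOfModules.LocalGeneratorsData.{u} (R := X.ringCatSheaf) E,
    q.IsLocallyFreeData ∧ ∀ a, Finite (q.generators a).I ∧ Nat.card (q.generators a).I = r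

/-- A module of rank `r` has rank at most `r` (hence is a vector bundle,
`HasRankLE.isVectorBundle`). [folklore] -/
theorem HasRank.hasRankLE {X : Scheme.{u}} {E : X.Modules} {r : ℕ} (h : HasRank E r) :
    HasRankLE E r := by
  obtain ⟨q, hq, hr⟩ := h
  exact ⟨q, hq, fun a => ⟨(hr a).1, (hr a).2.le⟩⟩

/-! ### Fibres and thickenings of a `W(k)`-scheme; lifting of vector bundles -/

namespace WittScheme

section Fibres

variable {p : ℕ} [Fact p.Prime] {k : Type u} [CommRing k] (𝒳 : SchemeOver (WittVector p k))

/-- The special fibre `X_k = 𝒳 ×_W Spec k` of a `W(k)`-scheme, as a `k`-scheme (base change along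
the residue map `W(k) → k`; Berthelot–Ogus 1983, (2.4): "`X₀`"). [cite: BerthelotOgus1983, Thm. 2.4] -/
def specialFibre : SchemeOver k :=
  (baseChangeHom (WittVector.constantCoeff : WittVector p k →+* k)).obj 𝒳

/-- The generic fibre `X_K = 𝒳 ×_W Spec K`, `K = W[1/p]`, as a `K`-scheme (Berthelot–Ogus 1983,
Cor. 2.5 and (3.8): the de Rham side `H_dR(X/V) ⊗ K = H_dR(X_K/K)`). [cite: BerthelotOgus1983, Cor. 2.5] -/
def genericFibre : SchemeOver K(p, k) :=
  (baseChange (WittVector p k) K(p, k)).obj 𝒳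

/-- The closed immersion `X_k ⟶ 𝒳` (on underlying schemes). [folklore] -/
def specialFibreι : (specialFibre 𝒳).left ⟶ 𝒳.left := baseChangeHomFst _ 𝒳

/-- The morphism `X_K ⟶ 𝒳` (on underlying schemes). [folklore] -/
def genericFibreι : (genericFibre 𝒳).left ⟶ 𝒳.left := baseChangeHomFst _ 𝒳

/-- The `n`-th thickening `X_n = 𝒳 ⊗_W W/pⁿ` of the special fibre, as a `W_n`-scheme (`X_0 = ∅`,
`X_1 ≅ X_k`; Bloch–Esnault–Kerz 2014, §1). [cite: BlochEsnaultKerz2014pAdic, §1] -/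
def thickening (n : ℕ) : SchemeOver (wittQuot p k n) :=
  (baseChange (WittVector p k) (wittQuot p k n)).obj 𝒳

/-- The closed immersion `X_n ⟶ 𝒳` (on underlying schemes). [folklore] -/
def thickeningι (n : ℕ) : (thickening 𝒳 n).left ⟶ 𝒳.left := baseChangeHomFst _ 𝒳

/-- The transition closed immersion `X_m ⟶ X_n` for `m ≤ n`, induced by `W_n → W_m`. [folklore] -/
def thickeningMap {m n : ℕ} (h : m ≤ n) : (thickening 𝒳 m).left ⟶ (thickening 𝒳 n).left :=
  pullback.map 𝒳.hom (Spec.map (CommRingCat.ofHom (algebraMap (WittVector p k) (wittQuot p k m))))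
    𝒳.hom (Spec.map (CommRingCat.ofHom (algebraMap (WittVector p k) (wittQuot p k n))))
    (𝟙 _) (Spec.map (CommRingCat.ofHom (Ideal.Quotient.factor (Ideal.pow_le_pow_right h)))) (𝟙 _)
    (by rw [Category.comp_id, Category.id_comp])
    (by rw [Category.comp_id, ← Spec.map_comp, ← CommRingCat.ofHom_comp]; rfl)

/-- `X_m ⟶ X_n ⟶ 𝒳` is `X_m ⟶ 𝒳`. [folklore] -/
@[reassoc]
theorem thickeningMap_ι {m n : ℕ} (h : m ≤ n) :
    thickeningMap 𝒳 h ≫ thickeningι 𝒳 n = thickeningι 𝒳 m :=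
  (pullback.lift_fst _ _ _).trans (Category.comp_id _)

/-- Restriction `E|_{X_k}` of an `𝒪_𝒳`-module to the special fibre (Mathlib
`Scheme.Modules.pullback`). [folklore] -/
abbrev restrictSpecial (E : 𝒳.left.Modules) : (specialFibre 𝒳).left.Modules :=
  (Scheme.Modules.pullback (specialFibreι 𝒳)).obj E

/-- Restriction `E|_{X_K}` of an `𝒪_𝒳`-module to the generic fibre. [folklore] -/
abbrev restrictGeneric (E : 𝒳.left.Modules) : (genericFibre 𝒳).left.Modules :=
  (Scheme.Modules.pullback (genericFibreι 𝒳)).obj E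

/-- `E₁` on `X_k` *lifts to `𝒳`* (algebraically): some vector bundle on `𝒳` restricts to `E₁`
(the composite "deformation + algebraization", Bloch–Esnault–Kerz 2014, §1). [cite: BlochEsnaultKerz2014pAdic, §1] -/
def LiftsTo (E₁ : (specialFibre 𝒳).left.Modules) : Prop :=
  ∃ E : 𝒳.left.Modules, IsVectorBundle E ∧ Nonempty (restrictSpecial 𝒳 E ≅ E₁)

variable [CharP k p]

/-- The closed immersion `X_k ⟶ X_{n+1}` induced by `W_{n+1} → k` (an isomorphism onto `X_1` for
`n = 0`). [folklore] -/
def specialFibreToThickening (n : ℕ) : (specialFibre 𝒳).left ⟶ (thickening 𝒳 (n + 1)).left :=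
  pullback.map 𝒳.hom (Spec.map (CommRingCat.ofHom WittVector.constantCoeff)) 𝒳.hom
    (Spec.map (CommRingCat.ofHom (algebraMap (WittVector p k) (wittQuot p k (n + 1)))))
    (𝟙 _) (Spec.map (CommRingCat.ofHom (wittQuotToResidue p k n))) (𝟙 _)
    (by rw [Category.comp_id, Category.id_comp])
    (by rw [Category.comp_id, ← Spec.map_comp, ← CommRingCat.ofHom_comp,
      wittQuotToResidue_comp_algebraMap])

/-- `X_k ⟶ X_{n+1} ⟶ 𝒳` is `X_k ⟶ 𝒳`. [folklore] -/
@[reassoc]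
theorem specialFibreToThickening_ι (n : ℕ) :
    specialFibreToThickening 𝒳 n ≫ thickeningι 𝒳 (n + 1) = specialFibreι 𝒳 :=
  (pullback.lift_fst _ _ _).trans (Category.comp_id _)

/-- `E₁` on `X_k` *lifts to the thickening `X_{n+1}`*: some vector bundle on `X_{n+1}` restricts to
(a module isomorphic to) `E₁` along `X_k ⟶ X_{n+1}` (Bloch–Esnault–Kerz 2014, §1, the deformation
problem `K₀(X_n) → K₀(X_1)`, at the level of objects). [cite: BlochEsnaultKerz2014pAdic, §1] -/
def LiftsToThickening (E₁ : (specialFibre 𝒳).left.Modules) (n : ℕ) : Prop :=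
  ∃ E : (thickening 𝒳 (n + 1)).left.Modules, IsVectorBundle E ∧
    Nonempty ((Scheme.Modules.pullback (specialFibreToThickening 𝒳 n)).obj E ≅ E₁)

/-- `E₁` on `X_k` *lifts formally*, i.e. to the `p`-adic formal completion of `𝒳`: there is a
compatible system `(E_n)_{n ≥ 1}` of vector bundles on the thickenings, `E_{n+1}|_{X_n} ≅ E_n`,
with `E_1|_{X_k} ≅ E₁` ("lifts to a line bundle on the formal scheme", Berthelot–Ogus 1983,
Thm. 3.8; `ξ̂ ∈ lim K₀(X_n)`, Bloch–Esnault–Kerz 2014, Thm. 1.3 (b), at the level of objects).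
Indexing: `E n` lives on `X_{n+1}`. [cite: BerthelotOgus1983, Thm. 3.8] -/
def LiftsFormally (E₁ : (specialFibre 𝒳).left.Modules) : Prop :=
  ∃ E : ∀ n : ℕ, (thickening 𝒳 (n + 1)).left.Modules,
    (∀ n, IsVectorBundle (E n)) ∧
    (∀ n, Nonempty ((Scheme.Modules.pullback
      (thickeningMap 𝒳 (Nat.le_succ (n + 1)))).obj (E (n + 1)) ≅ E n)) ∧
    Nonempty ((Scheme.Modules.pullback (specialFibreToThickening 𝒳 0)).obj (E 0) ≅ E₁)

end Fibres

section Model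

variable {p : ℕ} [Fact p.Prime] {k : Type u} [Field k] [CharP k p]

/-- `𝒳` is a *smooth proper model of relative dimension `n` over `W(k)`* with smooth projective
fibres: `𝒳 → Spec W` is smooth of relative dimension `n` and proper (the hypothesis "smooth proper
`V`-scheme" of Berthelot–Ogus 1983, Cor. 2.5 and Thm. 3.8, with `V = W`), and both fibres `X_k`,
`X_K` are smooth projective geometrically integral varieties of dimension `n` (so that the axioms of
the Weil cohomology theories of this directory apply to them; automatic, except for geometric
irreducibility, when `𝒳/W` is smooth projective with geometrically connected fibres). [cite: BerthelotOgus1983, Cor. 2.5] -/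
structure IsSmoothProperModel (n : ℕ) (𝒳 : SchemeOver (WittVector p k)) : Prop where
  /-- `𝒳 → Spec W` is smooth of relative dimension `n`. -/
  smoothOfRelativeDimension : SmoothOfRelativeDimension n 𝒳.hom
  /-- `𝒳 → Spec W` is proper. -/
  isProper : IsProper 𝒳.hom
  /-- The special fibre is a smooth projective variety of dimension `n` over `k`. -/
  isSmoothProjective_specialFibre : IsSmoothProjective n (specialFibre 𝒳)
  /-- The generic fibre is a smooth projective variety of dimension `n` over `K = W[1/p]`. -/
  isSmoothProjective_genericFibre : IsSmoothProjective n (genericFibre 𝒳)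

end Model

end WittScheme

open WittScheme

/-! ### The hypothesis structure -/

/-- A **crystalline realization** over the perfect field `k` of characteristic `p`: rational
crystalline cohomology `X ↦ H•_cris(X/W) ⊗_W K` as a Weil cohomology theory on smooth projective
`k`-varieties with coefficients in `K = K(p, k)` (Berthelot 1974; Katz–Messing 1974;
Gillet–Messing 1987), TOGETHER WITH (1) the integral lattices `Hⁱ_cris(X/W)` (finite `W`-modules,
maps `ι` into the rational groups inducing `Hⁱ_cris ⊗ K ≅ Hⁱ`) and the `σ`-semilinear Frobenius on
both; (2) an algebraic de Rham realization `dR` of `K`-varieties and the Berthelot–Ogus comparison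
maps `bo 𝒳 i : Hⁱ(X_k) → Hⁱ_dR(X_K/K)`, bijective and functorial for smooth proper `𝒳/W`
(Berthelot–Ogus 1983, Thm. 2.4, Cor. 2.5); (3) the crystalline and de Rham Chern characters of
vector bundles, additive, functorial, algebraic, and compatible under `bo` (Gros 1985;
Berthelot–Ogus 1983, Cor. 3.7, Rem. 3.7.1; Bloch–Esnault–Kerz 2014, §2); (4) cycle classes in the
`φ = pʳ` eigenspace (Ogus 1982, §4). The classical theory is a value of this structure; that fact is
not expressible in Mathlib (no crystalline site). See the module docstring for what is omitted and
for the named-fact pattern by which deep theorems about the classical value are consumed. [cite: BerthelotOgus1983, Thm. 2.4 and Cor. 2.5] -/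
structure CrystallineRealization (p : ℕ) [Fact p.Prime] (k : Type u) [Field k] [CharP k p]
    [PerfectRing k p] extends WeilCohomology k K(p, k) where
  /-- (1) The integral crystalline cohomology `X ↦ Hⁱ_cris(X/W)`, a contravariant functor to
  `W`-modules (Berthelot 1974; Illusie 1979: `Hⁱ(X, WΩ•)`). -/
  Hcris : ℕ → (SchemeOver k)ᵒᵖ ⥤ ModuleCat.{u} (WittVector p k)
  /-- The rationalisation map `Hⁱ_cris(X/W) → Hⁱ_cris(X/W) ⊗_W K = Hⁱ(X)`, semilinear along
  `W → K`. -/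
  ι (X : SchemeOver k) (i : ℕ) :
    (Hcris i).obj (op X) →ₛₗ[algebraMap (WittVector p k) K(p, k)] toPreWeilCohomology.obj X i
  /-- `ι` is natural: it commutes with pull-backs. -/
  ι_naturality : ∀ ⦃X Y : SchemeOver k⦄ (f : X ⟶ Y) (i : ℕ) (y : (Hcris i).obj (op Y)),
    ι X i ((Hcris i).map f.op y) = toPreWeilCohomology.pullback f i (ι Y i y)
  /-- `Hⁱ_cris(X/W)` is a finitely generated `W`-module for `X` smooth projective
  (Berthelot 1974, VII.1.1.1). -/
  finite_Hcris : ∀ ⦃n : ℕ⦄ ⦃X : SchemeOver k⦄, IsSmoothProjective n X →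
    ∀ i : ℕ, Module.Finite (WittVector p k) ((Hcris i).obj (op X))
  /-- `ι ⊗ K` is surjective: the image of `Hⁱ_cris(X/W)` spans `Hⁱ(X)` over `K`. -/
  span_range_ι : ∀ ⦃n : ℕ⦄ ⦃X : SchemeOver k⦄, IsSmoothProjective n X →
    ∀ i : ℕ, Submodule.span K(p, k) (Set.range (ι X i)) = ⊤
  /-- `ι ⊗ K` is injective: the kernel of `ι` is exactly the (`p`-power) torsion. -/
  ι_eq_zero_iff : ∀ ⦃n : ℕ⦄ ⦃X : SchemeOver k⦄, IsSmoothProjective n X →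
    ∀ (i : ℕ) (x : (Hcris i).obj (op X)),
      ι X i x = 0 ↔ ∃ m : ℕ, (p : WittVector p k) ^ m • x = 0
  /-- The Frobenius `φ : Hⁱ_cris(X/W) → Hⁱ_cris(X/W)`, semilinear over the Witt-vector Frobenius
  `σ` (induced by the absolute Frobenius of `X`; Berthelot–Ogus 1983, §1; Illusie 1979). -/
  frob (X : SchemeOver k) (i : ℕ) :
    (Hcris i).obj (op X) →ₛₗ[(WittVector.frobenius : WittVector p k →+* WittVector p k)]
      (Hcris i).obj (op X)
  /-- The rational Frobenius `φ ⊗ K` on `Hⁱ(X)`, a `σ`-semilinear automorphism (an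
  `F`-isocrystal: `φ` is an isogeny, Berthelot–Ogus 1983, Thm. 1.3). -/
  frobK (X : SchemeOver k) (i : ℕ) :
    toPreWeilCohomology.obj X i ≃ᶠˡ[p, k] toPreWeilCohomology.obj X i
  /-- `φ ⊗ K` extends `φ`. -/
  frobK_ι : ∀ (X : SchemeOver k) (i : ℕ) (x : (Hcris i).obj (op X)),
    frobK X i (ι X i x) = ι X i (frob X i x)
  /-- Frobenius commutes with pull-backs (naturality of the absolute Frobenius). -/
  frobK_pullback : ∀ ⦃X Y : SchemeOver k⦄ (f : X ⟶ Y) (i : ℕ) (y : toPreWeilCohomology.obj Y i),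
    frobK X i (toPreWeilCohomology.pullback f i y) = toPreWeilCohomology.pullback f i (frobK Y i y)
  /-- Frobenius is multiplicative: `φ(a ∪ b) = φ a ∪ φ b`. -/
  frobK_cup : ∀ ⦃n : ℕ⦄ ⦃X : SchemeOver k⦄, IsSmoothProjective n X →
    ∀ ⦃i j l : ℕ⦄ (h : i + j = l) (a : toPreWeilCohomology.obj X i)
      (b : toPreWeilCohomology.obj X j), frobK X l (cup h a b) = cup h (frobK X i a) (frobK X j b)
  /-- (4) The class of a codimension-`r` prime cycle is a Tate class: `φ(cl Z) = pʳ · cl Z`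
  (Ogus 1982, §4, before (4.11): "cohomology classes of algebraic cycles will be absolutely Tate";
  Gillet–Messing 1987). -/
  frobK_cycleClass : ∀ ⦃n : ℕ⦄ ⦃X : SchemeOver k⦄, IsSmoothProjective n X →
    ∀ (r : ℕ) (z : X.left), Order.coheight z = r →
      frobK X (2 * r) (cycleClass X r z) = ((p : K(p, k)) ^ r) • cycleClass X r z
  /-- (2) Algebraic de Rham cohomology of `K`-varieties with its Hodge filtration
  (`Motives/DeRhamRealization`), the target of the comparison. -/
  dR : DeRhamRealization K(p, k)
  /-- The Berthelot–Ogus comparison map `σ_cris⁻¹ : Hⁱ_cris(X_k/W) ⊗ K → Hⁱ_dR(X_K/K)` for a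
  `W`-scheme `𝒳` with fibres `X_k`, `X_K` (Berthelot–Ogus 1983, Thm. 2.4, Cor. 2.5). -/
  bo (𝒳 : SchemeOver (WittVector p k)) (i : ℕ) :
    toPreWeilCohomology.obj (specialFibre 𝒳) i →ₗ[K(p, k)] dR.obj (genericFibre 𝒳) i
  /-- `bo` is an isomorphism for `𝒳/W` smooth and proper (Berthelot–Ogus 1983, Cor. 2.5). -/
  bijective_bo : ∀ ⦃n : ℕ⦄ ⦃𝒳 : SchemeOver (WittVector p k)⦄, IsSmoothProperModel n 𝒳 →
    ∀ i : ℕ, Function.Bijective (bo 𝒳 i)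
  /-- `bo` is canonical, i.e. natural in `W`-morphisms (Berthelot–Ogus 1983, (2.4.5)). -/
  bo_naturality : ∀ ⦃𝒳 𝒴 : SchemeOver (WittVector p k)⦄ (h : 𝒳 ⟶ 𝒴) (i : ℕ)
    (y : toPreWeilCohomology.obj (specialFibre 𝒴) i),
    bo 𝒳 i (toPreWeilCohomology.pullback ((baseChangeHom _).map h) i y) =
      dR.pullback ((baseChange _ _).map h) i (bo 𝒴 i y)
  /-- (3) The `r`-th component `chᵣ(E) ∈ H²ʳ_cris(X/W)_K` of the crystalline Chern character of an
  `𝒪_X`-module (meaningful on vector bundles; Gros 1985; Bloch–Esnault–Kerz 2014, (2.11)). -/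
  chCris (X : SchemeOver k) (E : X.left.Modules) (r : ℕ) : toPreWeilCohomology.obj X (2 * r)
  /-- The `r`-th component of the de Rham Chern character of an `𝒪_Y`-module on a `K`-scheme
  (meaningful on vector bundles; Grothendieck 1958 / Berthelot–Ogus 1983, §3). -/
  chDR (Y : SchemeOver K(p, k)) (E : Y.left.Modules) (r : ℕ) : dR.obj Y (2 * r)
  /-- Isomorphic modules have the same crystalline Chern character. -/
  chCris_congr : ∀ ⦃X : SchemeOver k⦄ ⦃E E' : X.left.Modules⦄ (_ : E ≅ E') (r : ℕ),
    chCris X E r = chCris X E' r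
  /-- Isomorphic modules have the same de Rham Chern character. -/
  chDR_congr : ∀ ⦃Y : SchemeOver K(p, k)⦄ ⦃E E' : Y.left.Modules⦄ (_ : E ≅ E') (r : ℕ),
    chDR Y E r = chDR Y E' r
  /-- `ch^cris` is functorial on vector bundles: `f* chᵣ(E) = chᵣ(f* E)`. -/
  pullback_chCris : ∀ ⦃X Y : SchemeOver k⦄ (f : X ⟶ Y) (E : Y.left.Modules), IsVectorBundle E →
    ∀ r : ℕ, toPreWeilCohomology.pullback f (2 * r) (chCris Y E r) =
      chCris X ((Scheme.Modules.pullback f.left).obj E) r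
  /-- `ch^dR` is functorial on vector bundles. -/
  pullback_chDR : ∀ ⦃Y Y' : SchemeOver K(p, k)⦄ (f : Y ⟶ Y') (E : Y'.left.Modules),
    IsVectorBundle E → ∀ r : ℕ, dR.pullback f (2 * r) (chDR Y' E r) =
      chDR Y ((Scheme.Modules.pullback f.left).obj E) r
  /-- `ch^cris` is additive on short exact sequences of vector bundles (Gros 1985: `ch` is a ring
  homomorphism on `K₀(X)`, Bloch–Esnault–Kerz 2014, (2.12)). -/
  chCris_shortExact : ∀ ⦃X : SchemeOver k⦄ (S : ShortComplex X.left.Modules), S.ShortExact →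
    IsVectorBundle S.X₁ → IsVectorBundle S.X₃ →
      ∀ r : ℕ, chCris X S.X₂ r = chCris X S.X₁ r + chCris X S.X₃ r
  /-- `ch^dR` is additive on short exact sequences of vector bundles. -/
  chDR_shortExact : ∀ ⦃Y : SchemeOver K(p, k)⦄ (S : ShortComplex Y.left.Modules), S.ShortExact →
    IsVectorBundle S.X₁ → IsVectorBundle S.X₃ →
      ∀ r : ℕ, chDR Y S.X₂ r = chDR Y S.X₁ r + chDR Y S.X₃ r
  /-- On a smooth projective `X/k`, `chᵣ(E)` is the class of an algebraic cycle with
  `ℚ`-coefficients (`ch` is a rational polynomial in the Chern classes, which are cycle classes: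
  Gros 1985; Gillet–Messing 1987). Hypothesis-free in `E` (junk value `0` off bundles). -/
  chCris_mem_ratAlgebraicClasses : ∀ ⦃n : ℕ⦄ ⦃X : SchemeOver k⦄, IsSmoothProjective n X →
    ∀ (E : X.left.Modules) (r : ℕ), chCris X E r ∈ toPreWeilCohomology.ratAlgebraicClasses X r
  /-- On a smooth projective `Y/K`, `chᵣ^dR(E)` is the class of an algebraic cycle with
  `ℚ`-coefficients (Grothendieck 1958, §3). Hypothesis-free in `E` (junk value `0` off bundles). -/
  chDR_mem_ratAlgebraicClasses : ∀ ⦃n : ℕ⦄ ⦃Y : SchemeOver K(p, k)⦄, IsSmoothProjective n Y →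
    ∀ (E : Y.left.Modules) (r : ℕ), chDR Y E r ∈ dR.ratAlgebraicClasses Y r
  /-- COMPARISON: for a vector bundle `E` on a smooth proper `𝒳/W`, the Berthelot–Ogus map takes
  `ch^cris(E|_{X_k})` to `ch^dR(E|_{X_K})` (Berthelot–Ogus 1983, Prop. 3.4, Cor. 3.7 for `c₁` of
  line bundles, Rem. 3.7.1 for Chern classes of vector bundles; Bloch–Esnault–Kerz 2014, §1). -/
  bo_chCris : ∀ ⦃n : ℕ⦄ ⦃𝒳 : SchemeOver (WittVector p k)⦄, IsSmoothProperModel n 𝒳 →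
    ∀ (E : 𝒳.left.Modules), IsVectorBundle E → ∀ r : ℕ,
      bo 𝒳 (2 * r) (chCris (specialFibre 𝒳) (restrictSpecial 𝒳 E) r) =
        chDR (genericFibre 𝒳) (restrictGeneric 𝒳 E) r

namespace CrystallineRealization

variable {p : ℕ} [Fact p.Prime] {k : Type u} [Field k] [CharP k p] [PerfectRing k p]
  (C : CrystallineRealization p k)

/-! ### Tate classes: the `φ = pʳ` eigenspace -/

/-- The (untwisted) **Tate classes** in degree `2r`: the additive subgroup
`{x ∈ H²ʳ(X) | φ x = pʳ x}` (a `ℚ_p`-structure, not a `K`-subspace, `φ` being semilinear;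
Ogus 1982, (4.1.2), stated there after a Tate twist as `Φ ξ = ξ`). [cite: Ogus1982, (4.1.2)] -/
def tateClasses (X : SchemeOver k) (r : ℕ) : AddSubgroup (C.obj X (2 * r)) where
  carrier := {x | C.frobK X (2 * r) x = ((p : K(p, k)) ^ r) • x}
  zero_mem' := by simp
  add_mem' := by
    intro a b ha hb
    simp only [Set.mem_setOf_eq, map_add, smul_add] at ha hb ⊢
    rw [ha, hb]
  neg_mem' := by
    intro a ha
    simp only [Set.mem_setOf_eq, map_neg, smul_neg] at ha ⊢
    rw [ha]

/-- Membership in `tateClasses` is the eigen-equation `φ x = pʳ x`. [folklore] -/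
theorem mem_tateClasses_iff {X : SchemeOver k} {r : ℕ} {x : C.obj X (2 * r)} :
    x ∈ C.tateClasses X r ↔ C.frobK X (2 * r) x = ((p : K(p, k)) ^ r) • x := Iff.rfl

variable {n : ℕ} {X : SchemeOver k}

/-- The lattice of integral algebraic classes lies in the `φ = pʳ` eigenspace (from
`frobK_cycleClass`; Ogus 1982, §4). [cite: Ogus1982, §4] -/
theorem algebraicLattice_le_tateClasses (hX : IsSmoothProjective n X) (r : ℕ) :
    C.algebraicLattice X r ≤ C.tateClasses X r := by
  refine (AddSubgroup.closure_le _).mpr ?_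
  rintro _ ⟨⟨z, hz⟩, rfl⟩
  exact C.frobK_cycleClass hX r z hz

/-- Classes of `ℚ`-cycles are Tate classes: if `N x` is integral algebraic with `N ≠ 0` then
`N (φ x - pʳ x) = 0` in the `K`-vector space `H²ʳ(X)`, `char K = 0` (Ogus 1982, §4). [cite: Ogus1982, §4] -/
theorem ratAlgebraicClasses_le_tateClasses (hX : IsSmoothProjective n X) (r : ℕ) :
    C.ratAlgebraicClasses X r ≤ C.tateClasses X r := by
  rintro x ⟨N, hN, hx⟩
  have h := C.algebraicLattice_le_tateClasses hX r hx
  rw [mem_tateClasses_iff] at h ⊢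
  rw [← Int.cast_smul_eq_zsmul K(p, k), LinearEquiv.map_smulₛₗ, map_intCast, smul_comm] at h
  exact smul_right_injective _ (Int.cast_ne_zero.mpr hN : ((N : ℤ) : K(p, k)) ≠ 0) h

/-- **`φ(chᵣ) = pʳ chᵣ`**: the crystalline Chern character of a module on a smooth projective `X/k`
is a Tate class (Gros 1985; here a formal consequence of `chCris_mem_ratAlgebraicClasses` and
`frobK_cycleClass`). [cite: BlochEsnaultKerz2014pAdic, §2 (2.11)–(2.12)] -/
theorem frobK_chCris (hX : IsSmoothProjective n X) (E : X.left.Modules) (r : ℕ) :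
    C.frobK X (2 * r) (C.chCris X E r) = ((p : K(p, k)) ^ r) • C.chCris X E r :=
  C.ratAlgebraicClasses_le_tateClasses hX r (C.chCris_mem_ratAlgebraicClasses hX E r)

/-- The de Rham Chern character of a module on a smooth projective `Y/K` lies in the Hodge
filtration, `chᵣ^dR(E) ∈ Fʳ H²ʳ_dR(Y/K)` (algebraic classes are of type `(r, r)`;
`DeRhamRealization.mem_fil_of_mem_algebraicClasses`). [folklore] -/
theorem chDR_mem_fil {m : ℕ} {Y : SchemeOver K(p, k)} (hY : IsSmoothProjective m Y)
    (E : Y.left.Modules) (r : ℕ) : C.chDR Y E r ∈ C.dR.fil (2 * r) r :=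
  C.dR.mem_fil_of_mem_algebraicClasses hY r
    (C.dR.ratAlgebraicClasses_le_algebraicClasses Y r (C.chDR_mem_ratAlgebraicClasses hY E r))

/-! ### The Bloch–Esnault–Kerz Hodge condition -/

/-- The **Hodge condition** on a module `E₁` on the special fibre of `𝒳/W`:
`Φ⁻¹ ch^cris(E₁) ∈ ⊕ᵣ Fʳ H²ʳ_dR(X_K/K)`, i.e. every component of its crystalline Chern character
is carried by the Berthelot–Ogus map into the Hodge filtration of the generic fibre
(Bloch–Esnault–Kerz 2014, Thm. 1.3 (a); for `r = 1` and a line bundle this is the condition of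
Berthelot–Ogus 1983, Thm. 3.8). [cite: BlochEsnaultKerz2014pAdic, Thm. 1.3 (a)] -/
def HodgeCondition (𝒳 : SchemeOver (WittVector p k)) (E₁ : (specialFibre 𝒳).left.Modules) :
    Prop :=
  ∀ r : ℕ, C.bo 𝒳 (2 * r) (C.chCris (specialFibre 𝒳) E₁ r) ∈ C.dR.fil (2 * r) r

variable {𝒳 : SchemeOver (WittVector p k)}

/-- The restriction to `X_k` of a vector bundle on a smooth proper `𝒳/W` satisfies the Hodge
condition: `bo (ch^cris(E|_{X_k})) = ch^dR(E|_{X_K}) ∈ ⊕ᵣ Fʳ` (`bo_chCris`, `chDR_mem_fil`). This is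
the elementary direction (b) ⇒ (a) of Bloch–Esnault–Kerz 2014, Thm. 1.3, for classes of bundles
that extend to `𝒳` itself. [cite: BlochEsnaultKerz2014pAdic, Thm. 1.3] -/
theorem hodgeCondition_restrictSpecial (h𝒳 : IsSmoothProperModel n 𝒳) (E : 𝒳.left.Modules)
    (hE : IsVectorBundle E) : C.HodgeCondition 𝒳 (restrictSpecial 𝒳 E) := fun r => by
  rw [C.bo_chCris h𝒳 E hE r]
  exact C.chDR_mem_fil h𝒳.isSmoothProjective_genericFibre _ r

/-- A module on `X_k` that lifts to a vector bundle on `𝒳` satisfies the Hodge condition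
(`hodgeCondition_restrictSpecial` and invariance of `ch` under isomorphism). [cite: BlochEsnaultKerz2014pAdic, Thm. 1.3] -/
theorem hodgeCondition_of_liftsTo (h𝒳 : IsSmoothProperModel n 𝒳)
    {E₁ : (specialFibre 𝒳).left.Modules} (h : LiftsTo 𝒳 E₁) : C.HodgeCondition 𝒳 E₁ := by
  obtain ⟨E, hE, ⟨e⟩⟩ := h
  intro r
  rw [← C.chCris_congr e r]
  exact C.hodgeCondition_restrictSpecial h𝒳 E hE r

/-! ### Properties of the classical realization (hypothesis predicates on an explicit `C`) -/

/-- **Berthelot–Ogus lifting of line bundles** (Berthelot–Ogus 1983, Thm. 3.8, in the case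
`V = W(k)`, `e = 1`, `p > 2`, so that the integer `l` of loc. cit. is `0`, and `t = 0`): let `𝒳/W` be
smooth and proper such that `H²(𝒳, 𝒪_𝒳)` (`structureSheafCohomology`, equal to `H²` of the formal
completion by the theorem on formal functions) has no `p`-torsion, and let `L` be a line bundle on
the special fibre `X_k`. Then `L` lifts to a line bundle on the formal completion of `𝒳` (a
compatible system of lifts to all `X_n`, `LiftsFormally`) iff `c₁^cris(L) = ch₁^cris(L)` corresponds
under the Berthelot–Ogus isomorphism to an element of `F¹ H²_dR(X_K/K)`. A `Prop`-valued definition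
relative to `C`: a theorem for the classical crystalline realization, not provable for an arbitrary
`C` (named-fact pattern, see the module docstring). This is a *property of the realization `C`*
(its subject `C` is an explicit binder, as for `WeilCohomology.HasHardLefschetz`), consumed only as
a hypothesis `(h : C.BerthelotOgusLineBundleLifting)`; it is not asserted for every `C`, and no
discharge `∀ C, C.BerthelotOgusLineBundleLifting` can exist: in the twist of any `C` by zero Chern
characters it says that every line bundle on every such special fibre lifts formally
(`CrystallineRealizationProofs`: `forall_berthelotOgusLineBundleLifting_imp`), which fails for
`E × E`, `E` supersingular (Berthelot–Ogus 1983, Rem. 3.12.1). [cite: BerthelotOgus1983, Thm. 3.8] -/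
def BerthelotOgusLineBundleLifting (C : CrystallineRealization p k) : Prop :=
  ∀ ⦃n : ℕ⦄ ⦃𝒳 : SchemeOver (WittVector p k)⦄, IsSmoothProperModel n 𝒳 → p ≠ 2 →
    (∀ x : structureSheafCohomology 𝒳.left 2, (p : ℤ) • x = 0 → x = 0) →
    ∀ (L : (specialFibre 𝒳).left.Modules), HasRank L 1 →
      (LiftsFormally 𝒳 L ↔ C.bo 𝒳 (2 * 1) (C.chCris (specialFibre 𝒳) L 1) ∈ C.dR.fil (2 * 1) 1)

/-- Under `BerthelotOgusLineBundleLifting C`, a line bundle on `X_k` satisfying the full Hodge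
condition lifts formally (the case `q = 0` of p-adic semiregular lifting). [cite: BerthelotOgus1983, Thm. 3.8] -/
theorem liftsFormally_of_hodgeCondition (h : C.BerthelotOgusLineBundleLifting)
    (h𝒳 : IsSmoothProperModel n 𝒳) (hp : p ≠ 2)
    (hH : ∀ x : structureSheafCohomology 𝒳.left 2, (p : ℤ) • x = 0 → x = 0)
    {L : (specialFibre 𝒳).left.Modules} (hL : HasRank L 1) (hHodge : C.HodgeCondition 𝒳 L) :
    LiftsFormally 𝒳 L :=
  (h h𝒳 hp hH L hL).mpr (hHodge 1)

end CrystallineRealization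

end Literature.AlgebraicGeometry.Motives

end
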